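import Summits.BirchSwinnertonDyer.BirchSwinnertonDyer.Theorems.ManinLocalTwoThreeRootTermsOneSeventyOne
import HarnessLib

/-!
# Level 171 = 9·19 (crux C3): `|c| = 1` and `3 ∤ c` on each of the four classes MODULO ONE ROOT SQUEEZE (root-form transport at `p = 3`)

Cell bsd-f2-manin, route `ManinLocalTwoThree` (crux C3 `ManinPrimeToThreeAtNine`, stmt-BirchSwinnertonDyer-22968; `--supports` helper), LEAD p1 gen 27.
Part 2 of the LEVEL-171 programme (part 1 `…RootTermsOneSeventyOne`: the rows `D.f = rootForm w S ⊗ χ₋₃` with the roots `57b, 19a, 57c, 57a` as TERMS of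
`S₂(Γ₀(171))` in an g58's closure basis).  Here:
* §4 the root curves `57b1 = [1,0,1,−7,5]`, `19a1 = [0,1,1,−9,−15]`, `57c1 = [0,1,1,20,−32]`, `57a1 = [0,−1,1,−2,2]`: elliptic, globally minimal (kernel
  certificates `IntModelCond.isGloballyMinimal_mk_of_minCheck`), `57x1` MULTIPLICATIVE and `19a1` GOOD at `3`;
* §5 **`|c(D)| = 1` and `3 ∤ c(D)` on each genuine row MODULO THE ROOT SQUEEZE** — the displayed hypothesis `hsq :
  ∀ S (pointwise the η-seeds) L₀, IsNeronLatticeOf (W₀/ℂ) L₀ → Λ₁₇₁(rootForm w S) ⊆ Λ(L₀)`, quantifying over datum-free objects only (no named fact, no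
  definition), to be discharged by a weight-4 Bracket–Sturm certificate at level 171 (defect weight 20, Sturm depth 402; `x∘φ` nullity 46/40/40 for
  `57b/19a/57a`, **0 for `57c`** — that class needs another presentation); rows selected by `(a₂, a₅)`: `171a: a₂ = −1`, `171b: (0, −3)`, `171c: (2, −1)`,
  `171d: (2, 3)`; engine: p3 68.A `OddTwistRootForm.abs_maninConstant_eq_one_of_rootForm_charTwist_eq` at `p = 3` with `M = N = 171`.
WHAT THIS DOES NOT DO: the squeezes; the four ghost rows of an's certificate list (`(a₂,a₅) ∈ {(−2,−3),(−2,1),(0,3),(1,−2)}`, 3-depleted old classes) are not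
excluded (a Fricke-staged re-pinning removes them), so no unconditional `∀ D` statement at level 171 is claimed.  HONEST FRAMING: §4 unconditional, §5 CONDITIONAL
on the displayed hypotheses (standard axioms, no sorry); nothing here proves C2/C3, Manin's conjecture or BSD.
[cite: CremonaAlgorithms1997, §2.10, Table 1 (N = 19, 57, 171)] [cite: Stevens1989, Lemma (5.2) p. 96, Lemma (5.4) p. 97] [cite: AgasheRibetStein2006, §§1–2]
[cite: SilvermanAEC2009, VII.1 Remark 1.1, VII.5 Prop. 5.1] [cite: Shimura1971, Prop. 3.64]
-/

set_option autoImplicit false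
-- lint-debt: the directory name repeats the summit name (sibling precedent `ManinLocalTwoThreePinningOneSeventyOne.lean`)
set_option linter.dupNamespace false

noncomputable section

open Complex WeierstrassCurve
open UpperHalfPlane hiding I
open scoped MatrixGroups ModularForm
open ModularForm CongruenceSubgroup PowerSeries
open Literature.NumberTheory.ModularForms
open Literature.NumberTheory.EllipticCurves Literature.NumberTheory.EllipticCurves.ModularForms

namespace Summit.BirchSwinnertonDyer.BirchSwinnertonDyer.Theorems.ManinLocalTwoThree.LevelOneSeventyOne

open Summit.BirchSwinnertonDyer.BirchSwinnertonDyer.Theorems.ManinLocalTwoThree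
open Summit.BirchSwinnertonDyer.BirchSwinnertonDyer.Rank1Residual.IntModel
open Summit.BirchSwinnertonDyer.Rank1Residual.Additive
open BracketSturm PinningKernel PinningOneSeventyOne OddTwistRootForm

variable {W : WeierstrassCurve ℚ} [W.IsElliptic]

/-! ## §4 The root curves: elliptic, globally minimal, reduction at `3` -/

/-- `57b1 = [1, 0, 1, -7, 5]` is an elliptic curve (`Δ = 3249 = 3²·19²`). [cite: CremonaAlgorithms1997, Table 1 (57b1)] -/
theorem isElliptic_fiftySevenB : (⟨1, 0, 1, -7, 5⟩ : WeierstrassCurve ℚ).IsElliptic :=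
  ⟨by norm_num [WeierstrassCurve.Δ, WeierstrassCurve.b₂, WeierstrassCurve.b₄, WeierstrassCurve.b₆, WeierstrassCurve.b₈]⟩

/-- The literal `ℚ`-model of `57b1` read through integer casts. [folklore] -/
theorem mk_fiftySevenB_eq_cast : (⟨1, 0, 1, -7, 5⟩ : WeierstrassCurve ℚ) = ⟨((1 : ℤ) : ℚ), ((0 : ℤ) : ℚ), ((1 : ℤ) : ℚ), ((-7 : ℤ) : ℚ), ((5 : ℤ) : ℚ)⟩ := by
  ext <;> norm_num

/-- **`57b1` is globally minimal** (`Δ = 3249 = 3²·19²`, `c₄ = 313`; kernel certificate). [cite: SilvermanAEC2009, VII.1 Remark 1.1] -/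
theorem isGloballyMinimal_fiftySevenB : (⟨1, 0, 1, -7, 5⟩ : WeierstrassCurve ℚ).IsGloballyMinimal := by
  rw [mk_fiftySevenB_eq_cast]
  exact IntModelCond.isGloballyMinimal_mk_of_minCheck 1 (0) 1 (-7) (5) (cm := ⟨0, 0, 0, [⟨3, 1, 2, 0, 0⟩, ⟨19, 4, 2, 0, 0⟩]⟩) (by decide +kernel)

/-- The tree's integral model of `57b1`. [folklore] -/
theorem integralModelInt_fiftySevenB [(⟨1, 0, 1, -7, 5⟩ : WeierstrassCurve ℚ).IsGloballyMinimal] :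
    WeierstrassCurve.integralModelInt (⟨1, 0, 1, -7, 5⟩ : WeierstrassCurve ℚ) = ⟨1, 0, 1, -7, 5⟩ :=
  integralModelInt_eq_of_map_eq _ ((map_mk_int 1 (0) 1 (-7) (5)).trans mk_fiftySevenB_eq_cast.symm)

/-- **`57b1` is multiplicative at `3`** (`3 ∣ Δ = 3249 = 3²·19²`, `3 ∤ c₄ = 313`). [cite: SilvermanAEC2009, VII.5 Prop. 5.1(b)] -/
theorem hasMultiplicativeReductionAtPrime_three_fiftySevenB [Fact (Nat.Prime 3)] :
    (⟨1, 0, 1, -7, 5⟩ : WeierstrassCurve ℚ).HasMultiplicativeReductionAtPrime 3 := by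
  haveI := isElliptic_fiftySevenB
  haveI := isGloballyMinimal_fiftySevenB
  exact hasMultiplicativeReductionAtPrime_of_intModel (W := (⟨1, 0, 1, -7, 5⟩ : WeierstrassCurve ℚ)) integralModelInt_fiftySevenB 3 (by decide) (by decide)

/-- `19a1 = [0, 1, 1, -9, -15]` is an elliptic curve (`Δ = −6859 = −19³`). [cite: CremonaAlgorithms1997, Table 1 (19a1)] -/
theorem isElliptic_nineteenA : (⟨0, 1, 1, -9, -15⟩ : WeierstrassCurve ℚ).IsElliptic :=
  ⟨by norm_num [WeierstrassCurve.Δ, WeierstrassCurve.b₂, WeierstrassCurve.b₄, WeierstrassCurve.b₆, WeierstrassCurve.b₈]⟩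

/-- The literal `ℚ`-model of `19a1` read through integer casts. [folklore] -/
theorem mk_nineteenA_eq_cast : (⟨0, 1, 1, -9, -15⟩ : WeierstrassCurve ℚ) = ⟨((0 : ℤ) : ℚ), ((1 : ℤ) : ℚ), ((1 : ℤ) : ℚ), ((-9 : ℤ) : ℚ), ((-15 : ℤ) : ℚ)⟩ := by
  ext <;> norm_num

/-- **`19a1` is globally minimal** (`Δ = −6859 = −19³`, `c₄ = 448`; kernel certificate). [cite: SilvermanAEC2009, VII.1 Remark 1.1] -/
theorem isGloballyMinimal_nineteenA : (⟨0, 1, 1, -9, -15⟩ : WeierstrassCurve ℚ).IsGloballyMinimal := by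
  rw [mk_nineteenA_eq_cast]
  exact IntModelCond.isGloballyMinimal_mk_of_minCheck 0 (1) 1 (-9) (-15) (cm := ⟨0, 6, 3, [⟨19, 4, 3, 0, 0⟩]⟩) (by decide +kernel)

/-- **`19a1` has good reduction at `3`** (`3 ∤ Δ = −6859 = −19³`). [cite: SilvermanAEC2009, VII.5 Prop. 5.1(a)] -/
theorem hasGoodReductionAtPrime_three_nineteenA [Fact (Nat.Prime 3)] :
    (⟨0, 1, 1, -9, -15⟩ : WeierstrassCurve ℚ).HasGoodReductionAtPrime 3 := by
  haveI := isElliptic_nineteenA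
  refine WeierstrassCurve.hasGoodReductionAtPrime_of_map_int_of_not_dvd _ (⟨0, 1, 1, -9, -15⟩ : WeierstrassCurve ℤ)
    (by ext <;> simp) 3 fun h ↦ ?_
  have hΔ : (⟨0, 1, 1, -9, -15⟩ : WeierstrassCurve ℤ).Δ = -6859 := by
    norm_num [WeierstrassCurve.Δ, WeierstrassCurve.b₂, WeierstrassCurve.b₄, WeierstrassCurve.b₆, WeierstrassCurve.b₈]
  rw [hΔ] at h
  norm_num at h

/-- `57c1 = [0, 1, 1, 20, -32]` is an elliptic curve (`Δ = −1121931 = −3¹⁰·19`). [cite: CremonaAlgorithms1997, Table 1 (57c1)] -/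
theorem isElliptic_fiftySevenC : (⟨0, 1, 1, 20, -32⟩ : WeierstrassCurve ℚ).IsElliptic :=
  ⟨by norm_num [WeierstrassCurve.Δ, WeierstrassCurve.b₂, WeierstrassCurve.b₄, WeierstrassCurve.b₆, WeierstrassCurve.b₈]⟩

/-- The literal `ℚ`-model of `57c1` read through integer casts. [folklore] -/
theorem mk_fiftySevenC_eq_cast : (⟨0, 1, 1, 20, -32⟩ : WeierstrassCurve ℚ) = ⟨((0 : ℤ) : ℚ), ((1 : ℤ) : ℚ), ((1 : ℤ) : ℚ), ((20 : ℤ) : ℚ), ((-32 : ℤ) : ℚ)⟩ := by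
  ext <;> norm_num

/-- **`57c1` is globally minimal** (`Δ = −1121931 = −3¹⁰·19`, `c₄ = −944`; kernel certificate). [cite: SilvermanAEC2009, VII.1 Remark 1.1] -/
theorem isGloballyMinimal_fiftySevenC : (⟨0, 1, 1, 20, -32⟩ : WeierstrassCurve ℚ).IsGloballyMinimal := by
  rw [mk_fiftySevenC_eq_cast]
  exact IntModelCond.isGloballyMinimal_mk_of_minCheck 0 (1) 1 (20) (-32) (cm := ⟨0, 4, 3, [⟨3, 1, 10, 0, 0⟩, ⟨19, 4, 1, 0, 0⟩]⟩) (by decide +kernel)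

/-- The tree's integral model of `57c1`. [folklore] -/
theorem integralModelInt_fiftySevenC [(⟨0, 1, 1, 20, -32⟩ : WeierstrassCurve ℚ).IsGloballyMinimal] :
    WeierstrassCurve.integralModelInt (⟨0, 1, 1, 20, -32⟩ : WeierstrassCurve ℚ) = ⟨0, 1, 1, 20, -32⟩ :=
  integralModelInt_eq_of_map_eq _ ((map_mk_int 0 (1) 1 (20) (-32)).trans mk_fiftySevenC_eq_cast.symm)

/-- **`57c1` is multiplicative at `3`** (`3 ∣ Δ = −1121931 = −3¹⁰·19`, `3 ∤ c₄ = −944`). [cite: SilvermanAEC2009, VII.5 Prop. 5.1(b)] -/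
theorem hasMultiplicativeReductionAtPrime_three_fiftySevenC [Fact (Nat.Prime 3)] :
    (⟨0, 1, 1, 20, -32⟩ : WeierstrassCurve ℚ).HasMultiplicativeReductionAtPrime 3 := by
  haveI := isElliptic_fiftySevenC
  haveI := isGloballyMinimal_fiftySevenC
  exact hasMultiplicativeReductionAtPrime_of_intModel (W := (⟨0, 1, 1, 20, -32⟩ : WeierstrassCurve ℚ)) integralModelInt_fiftySevenC 3 (by decide) (by decide)

/-- `57a1 = [0, -1, 1, -2, 2]` is an elliptic curve (`Δ = −171 = −3²·19`). [cite: CremonaAlgorithms1997, Table 1 (57a1)] -/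
theorem isElliptic_fiftySevenA : (⟨0, -1, 1, -2, 2⟩ : WeierstrassCurve ℚ).IsElliptic :=
  ⟨by norm_num [WeierstrassCurve.Δ, WeierstrassCurve.b₂, WeierstrassCurve.b₄, WeierstrassCurve.b₆, WeierstrassCurve.b₈]⟩

/-- The literal `ℚ`-model of `57a1` read through integer casts. [folklore] -/
theorem mk_fiftySevenA_eq_cast : (⟨0, -1, 1, -2, 2⟩ : WeierstrassCurve ℚ) = ⟨((0 : ℤ) : ℚ), ((-1 : ℤ) : ℚ), ((1 : ℤ) : ℚ), ((-2 : ℤ) : ℚ), ((2 : ℤ) : ℚ)⟩ := by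
  ext <;> norm_num

/-- **`57a1` is globally minimal** (`Δ = −171 = −3²·19`, `c₄ = 112`; kernel certificate). [cite: SilvermanAEC2009, VII.1 Remark 1.1] -/
theorem isGloballyMinimal_fiftySevenA : (⟨0, -1, 1, -2, 2⟩ : WeierstrassCurve ℚ).IsGloballyMinimal := by
  rw [mk_fiftySevenA_eq_cast]
  exact IntModelCond.isGloballyMinimal_mk_of_minCheck 0 (-1) 1 (-2) (2) (cm := ⟨0, 4, 3, [⟨3, 1, 2, 0, 0⟩, ⟨19, 4, 1, 0, 0⟩]⟩) (by decide +kernel)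

/-- The tree's integral model of `57a1`. [folklore] -/
theorem integralModelInt_fiftySevenA [(⟨0, -1, 1, -2, 2⟩ : WeierstrassCurve ℚ).IsGloballyMinimal] :
    WeierstrassCurve.integralModelInt (⟨0, -1, 1, -2, 2⟩ : WeierstrassCurve ℚ) = ⟨0, -1, 1, -2, 2⟩ :=
  integralModelInt_eq_of_map_eq _ ((map_mk_int 0 (-1) 1 (-2) (2)).trans mk_fiftySevenA_eq_cast.symm)

/-- **`57a1` is multiplicative at `3`** (`3 ∣ Δ = −171 = −3²·19`, `3 ∤ c₄ = 112`). [cite: SilvermanAEC2009, VII.5 Prop. 5.1(b)] -/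
theorem hasMultiplicativeReductionAtPrime_three_fiftySevenA [Fact (Nat.Prime 3)] :
    (⟨0, -1, 1, -2, 2⟩ : WeierstrassCurve ℚ).HasMultiplicativeReductionAtPrime 3 := by
  haveI := isElliptic_fiftySevenA
  haveI := isGloballyMinimal_fiftySevenA
  exact hasMultiplicativeReductionAtPrime_of_intModel (W := (⟨0, -1, 1, -2, 2⟩ : WeierstrassCurve ℚ)) integralModelInt_fiftySevenA 3 (by decide) (by decide)

/-! ## §5 `|c| = 1` on each genuine row, modulo the root squeeze -/

/-- **Row `171a` selected by `a₂`**: `D.f = 57b|₁₇₁ ⊗ χ₋₃` for some seeds `S`. [cite: CremonaAlgorithms1997, Table 1 (171a)] -/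
theorem f_eq_charTwist_57b_of_lFunction (D : ModularParametrizationData W 171) (h2 : W.LFunction 2 = -1) :
    ∃ S : Fin 3 → CuspForm (Gamma0 171) 2, (∀ i, ∀ τ : ℍ, S i τ = etaQuotient 171 (expFn (Ls[(i : ℕ)]).1) τ) ∧
      D.f = charTwist 171 dvd_rfl nine_dvd (isQuadratic_quadraticChar_ringHomComp 3) (rootForm w57b S) := by
  obtain ⟨S, hS, h⟩ := f_cases D
  refine ⟨S, hS, ?_⟩
  have key : ∀ r : List (ℕ × ℤ) × ℤ × List ℤ, truth W [3, 2, 5, 7, 11, 13] = r.1 →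
      (r.1.getD 1 (0, 0)).2 = W.LFunction 2 ∧ (r.1.getD 2 (0, 0)).2 = W.LFunction 5 := fun r hr ↦ by
    constructor <;> simp [← hr, truth]
  rcases h with h | h | h | h | h | h | h | h
  · exact absurd ((key _ h).1.trans h2) (by decide)
  · exact absurd ((key _ h).1.trans h2) (by decide)
  · exact h.2
  · exact absurd ((key _ h.1).1.trans h2) (by decide)
  · exact absurd ((key _ h).1.trans h2) (by decide)
  · exact absurd ((key _ h).1.trans h2) (by decide)
  · exact absurd ((key _ h.1).1.trans h2) (by decide)
  · exact absurd ((key _ h.1).1.trans h2) (by decide)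

/-- **`|c| = 1` ON THE CLASS `171a = 57b ⊗ χ₋₃`, MODULO THE ROOT SQUEEZE `hsq`** (`Λ₁₇₁(57b|₁₇₁) ⊆ Λ_Néron([1, 0, 1, -7, 5])` for all seeds; lattice-optimal `X₀(171)`-data of globally
minimal models; p3 68.A at `p = 3` with `M = N = 171`). [cite: Stevens1989, Lemma (5.2) p. 96, Lemma (5.4) p. 97] [cite: AgasheRibetStein2006, §§1–2] -/
theorem abs_maninConstant_eq_one_171a_of_rootSqueeze (hsq : ∀ S : Fin 3 → CuspForm (Gamma0 171) 2, (∀ i, ∀ τ : ℍ, S i τ = etaQuotient 171 (expFn (Ls[(i : ℕ)]).1) τ) →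
      ∀ L₀ : PeriodPair, IsNeronLatticeOf ((⟨1, 0, 1, -7, 5⟩ : WeierstrassCurve ℚ).baseChange ℂ) L₀ → ∀ z ∈ periodLattice (rootForm w57b S), z ∈ L₀.lattice)
    (W : WeierstrassCurve ℚ) [W.IsElliptic] [W.IsGloballyMinimal] (D : ModularParametrizationData W 171) (h2 : W.LFunction 2 = -1)
    (hopt : ∀ z ∈ D.L.lattice, ∃ w ∈ periodLattice D.f, z = D.c * w) : |D.maninConstant| = 1 := by
  haveI : Fact (Nat.Prime 3) := ⟨Nat.prime_three⟩
  obtain ⟨S, hS, hf⟩ := f_eq_charTwist_57b_of_lFunction D h2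
  haveI := isElliptic_fiftySevenB
  haveI := isGloballyMinimal_fiftySevenB
  obtain ⟨L₀, hL₀⟩ := exists_isNeronLatticeOf_holds ((⟨1, 0, 1, -7, 5⟩ : WeierstrassCurve ℚ).baseChange ℂ)
  exact abs_maninConstant_eq_one_of_rootForm_charTwist_eq (p := 3) (by norm_num) (isQuadratic_quadraticChar_ringHomComp 3)
    (isPrimitive_quadraticChar_ringHomComp 3 (by norm_num)) (rootForm w57b S) (⟨1, 0, 1, -7, 5⟩ : WeierstrassCurve ℚ) L₀ hL₀ (hsq S hS L₀ hL₀)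
    (Or.inr hasMultiplicativeReductionAtPrime_three_fiftySevenB) W D dvd_rfl nine_dvd hf hopt

/-- **`3 ∤ c` on the class `171a`, modulo the root squeeze** (the C3 shape). [cite: AgasheRibetStein2006, §§1–2] -/
theorem not_three_dvd_maninConstant_171a_of_rootSqueeze (hsq : ∀ S : Fin 3 → CuspForm (Gamma0 171) 2, (∀ i, ∀ τ : ℍ, S i τ = etaQuotient 171 (expFn (Ls[(i : ℕ)]).1) τ) →
      ∀ L₀ : PeriodPair, IsNeronLatticeOf ((⟨1, 0, 1, -7, 5⟩ : WeierstrassCurve ℚ).baseChange ℂ) L₀ → ∀ z ∈ periodLattice (rootForm w57b S), z ∈ L₀.lattice)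
    (W : WeierstrassCurve ℚ) [W.IsElliptic] [W.IsGloballyMinimal] (D : ModularParametrizationData W 171) (h2 : W.LFunction 2 = -1)
    (hopt : ∀ z ∈ D.L.lattice, ∃ w ∈ periodLattice D.f, z = D.c * w) : ¬ (3 : ℤ) ∣ D.maninConstant := by
  intro hd
  have h1 := abs_maninConstant_eq_one_171a_of_rootSqueeze hsq W D h2 hopt
  have hn : D.maninConstant.natAbs = 1 := by
    rw [Int.abs_eq_natAbs] at h1
    exact_mod_cast h1
  have h2' : (3 : ℤ).natAbs ∣ 1 := hn ▸ Int.natAbs_dvd_natAbs.mpr hd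
  norm_num at h2'

/-- **Row `171b` selected by `a₂, a₅`**: `D.f = 19a|₁₇₁ ⊗ χ₋₃` for some seeds `S`. [cite: CremonaAlgorithms1997, Table 1 (171b)] -/
theorem f_eq_charTwist_19a_of_lFunction (D : ModularParametrizationData W 171) (h2 : W.LFunction 2 = 0) (h5 : W.LFunction 5 = -3) :
    ∃ S : Fin 3 → CuspForm (Gamma0 171) 2, (∀ i, ∀ τ : ℍ, S i τ = etaQuotient 171 (expFn (Ls[(i : ℕ)]).1) τ) ∧
      D.f = charTwist 171 dvd_rfl nine_dvd (isQuadratic_quadraticChar_ringHomComp 3) (rootForm w19a S) := by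
  obtain ⟨S, hS, h⟩ := f_cases D
  refine ⟨S, hS, ?_⟩
  have key : ∀ r : List (ℕ × ℤ) × ℤ × List ℤ, truth W [3, 2, 5, 7, 11, 13] = r.1 →
      (r.1.getD 1 (0, 0)).2 = W.LFunction 2 ∧ (r.1.getD 2 (0, 0)).2 = W.LFunction 5 := fun r hr ↦ by
    constructor <;> simp [← hr, truth]
  rcases h with h | h | h | h | h | h | h | h
  · exact absurd ((key _ h).1.trans h2) (by decide)
  · exact absurd ((key _ h).1.trans h2) (by decide)
  · exact absurd ((key _ h.1).1.trans h2) (by decide)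
  · exact h.2
  · exact absurd ((key _ h).2.trans h5) (by decide)
  · exact absurd ((key _ h).1.trans h2) (by decide)
  · exact absurd ((key _ h.1).1.trans h2) (by decide)
  · exact absurd ((key _ h.1).1.trans h2) (by decide)

/-- **`|c| = 1` ON THE CLASS `171b = 19a ⊗ χ₋₃`, MODULO THE ROOT SQUEEZE `hsq`** (`Λ₁₇₁(19a|₁₇₁) ⊆ Λ_Néron([0, 1, 1, -9, -15])` for all seeds; lattice-optimal `X₀(171)`-data of globally
minimal models; p3 68.A at `p = 3` with `M = N = 171`). [cite: Stevens1989, Lemma (5.2) p. 96, Lemma (5.4) p. 97] [cite: AgasheRibetStein2006, §§1–2] -/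
theorem abs_maninConstant_eq_one_171b_of_rootSqueeze (hsq : ∀ S : Fin 3 → CuspForm (Gamma0 171) 2, (∀ i, ∀ τ : ℍ, S i τ = etaQuotient 171 (expFn (Ls[(i : ℕ)]).1) τ) →
      ∀ L₀ : PeriodPair, IsNeronLatticeOf ((⟨0, 1, 1, -9, -15⟩ : WeierstrassCurve ℚ).baseChange ℂ) L₀ → ∀ z ∈ periodLattice (rootForm w19a S), z ∈ L₀.lattice)
    (W : WeierstrassCurve ℚ) [W.IsElliptic] [W.IsGloballyMinimal] (D : ModularParametrizationData W 171) (h2 : W.LFunction 2 = 0) (h5 : W.LFunction 5 = -3)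
    (hopt : ∀ z ∈ D.L.lattice, ∃ w ∈ periodLattice D.f, z = D.c * w) : |D.maninConstant| = 1 := by
  haveI : Fact (Nat.Prime 3) := ⟨Nat.prime_three⟩
  obtain ⟨S, hS, hf⟩ := f_eq_charTwist_19a_of_lFunction D h2 h5
  haveI := isElliptic_nineteenA
  haveI := isGloballyMinimal_nineteenA
  obtain ⟨L₀, hL₀⟩ := exists_isNeronLatticeOf_holds ((⟨0, 1, 1, -9, -15⟩ : WeierstrassCurve ℚ).baseChange ℂ)
  exact abs_maninConstant_eq_one_of_rootForm_charTwist_eq (p := 3) (by norm_num) (isQuadratic_quadraticChar_ringHomComp 3)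
    (isPrimitive_quadraticChar_ringHomComp 3 (by norm_num)) (rootForm w19a S) (⟨0, 1, 1, -9, -15⟩ : WeierstrassCurve ℚ) L₀ hL₀ (hsq S hS L₀ hL₀)
    (Or.inl hasGoodReductionAtPrime_three_nineteenA) W D dvd_rfl nine_dvd hf hopt

/-- **`3 ∤ c` on the class `171b`, modulo the root squeeze** (the C3 shape). [cite: AgasheRibetStein2006, §§1–2] -/
theorem not_three_dvd_maninConstant_171b_of_rootSqueeze (hsq : ∀ S : Fin 3 → CuspForm (Gamma0 171) 2, (∀ i, ∀ τ : ℍ, S i τ = etaQuotient 171 (expFn (Ls[(i : ℕ)]).1) τ) →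
      ∀ L₀ : PeriodPair, IsNeronLatticeOf ((⟨0, 1, 1, -9, -15⟩ : WeierstrassCurve ℚ).baseChange ℂ) L₀ → ∀ z ∈ periodLattice (rootForm w19a S), z ∈ L₀.lattice)
    (W : WeierstrassCurve ℚ) [W.IsElliptic] [W.IsGloballyMinimal] (D : ModularParametrizationData W 171) (h2 : W.LFunction 2 = 0) (h5 : W.LFunction 5 = -3)
    (hopt : ∀ z ∈ D.L.lattice, ∃ w ∈ periodLattice D.f, z = D.c * w) : ¬ (3 : ℤ) ∣ D.maninConstant := by
  intro hd
  have h1 := abs_maninConstant_eq_one_171b_of_rootSqueeze hsq W D h2 h5 hopt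
  have hn : D.maninConstant.natAbs = 1 := by
    rw [Int.abs_eq_natAbs] at h1
    exact_mod_cast h1
  have h2' : (3 : ℤ).natAbs ∣ 1 := hn ▸ Int.natAbs_dvd_natAbs.mpr hd
  norm_num at h2'

/-- **Row `171c` selected by `a₂, a₅`**: `D.f = 57c|₁₇₁ ⊗ χ₋₃` for some seeds `S`. [cite: CremonaAlgorithms1997, Table 1 (171c)] -/
theorem f_eq_charTwist_57c_of_lFunction (D : ModularParametrizationData W 171) (h2 : W.LFunction 2 = 2) (h5 : W.LFunction 5 = -1) :
    ∃ S : Fin 3 → CuspForm (Gamma0 171) 2, (∀ i, ∀ τ : ℍ, S i τ = etaQuotient 171 (expFn (Ls[(i : ℕ)]).1) τ) ∧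
      D.f = charTwist 171 dvd_rfl nine_dvd (isQuadratic_quadraticChar_ringHomComp 3) (rootForm w57c S) := by
  obtain ⟨S, hS, h⟩ := f_cases D
  refine ⟨S, hS, ?_⟩
  have key : ∀ r : List (ℕ × ℤ) × ℤ × List ℤ, truth W [3, 2, 5, 7, 11, 13] = r.1 →
      (r.1.getD 1 (0, 0)).2 = W.LFunction 2 ∧ (r.1.getD 2 (0, 0)).2 = W.LFunction 5 := fun r hr ↦ by
    constructor <;> simp [← hr, truth]
  rcases h with h | h | h | h | h | h | h | h
  · exact absurd ((key _ h).1.trans h2) (by decide)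
  · exact absurd ((key _ h).1.trans h2) (by decide)
  · exact absurd ((key _ h.1).1.trans h2) (by decide)
  · exact absurd ((key _ h.1).1.trans h2) (by decide)
  · exact absurd ((key _ h).1.trans h2) (by decide)
  · exact absurd ((key _ h).1.trans h2) (by decide)
  · exact h.2
  · exact absurd ((key _ h.1).2.trans h5) (by decide)

/-- **`|c| = 1` ON THE CLASS `171c = 57c ⊗ χ₋₃`, MODULO THE ROOT SQUEEZE `hsq`** (`Λ₁₇₁(57c|₁₇₁) ⊆ Λ_Néron([0, 1, 1, 20, -32])` for all seeds; lattice-optimal `X₀(171)`-data of globally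
minimal models; p3 68.A at `p = 3` with `M = N = 171`). [cite: Stevens1989, Lemma (5.2) p. 96, Lemma (5.4) p. 97] [cite: AgasheRibetStein2006, §§1–2] -/
theorem abs_maninConstant_eq_one_171c_of_rootSqueeze (hsq : ∀ S : Fin 3 → CuspForm (Gamma0 171) 2, (∀ i, ∀ τ : ℍ, S i τ = etaQuotient 171 (expFn (Ls[(i : ℕ)]).1) τ) →
      ∀ L₀ : PeriodPair, IsNeronLatticeOf ((⟨0, 1, 1, 20, -32⟩ : WeierstrassCurve ℚ).baseChange ℂ) L₀ → ∀ z ∈ periodLattice (rootForm w57c S), z ∈ L₀.lattice)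
    (W : WeierstrassCurve ℚ) [W.IsElliptic] [W.IsGloballyMinimal] (D : ModularParametrizationData W 171) (h2 : W.LFunction 2 = 2) (h5 : W.LFunction 5 = -1)
    (hopt : ∀ z ∈ D.L.lattice, ∃ w ∈ periodLattice D.f, z = D.c * w) : |D.maninConstant| = 1 := by
  haveI : Fact (Nat.Prime 3) := ⟨Nat.prime_three⟩
  obtain ⟨S, hS, hf⟩ := f_eq_charTwist_57c_of_lFunction D h2 h5
  haveI := isElliptic_fiftySevenC
  haveI := isGloballyMinimal_fiftySevenC
  obtain ⟨L₀, hL₀⟩ := exists_isNeronLatticeOf_holds ((⟨0, 1, 1, 20, -32⟩ : WeierstrassCurve ℚ).baseChange ℂ)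
  exact abs_maninConstant_eq_one_of_rootForm_charTwist_eq (p := 3) (by norm_num) (isQuadratic_quadraticChar_ringHomComp 3)
    (isPrimitive_quadraticChar_ringHomComp 3 (by norm_num)) (rootForm w57c S) (⟨0, 1, 1, 20, -32⟩ : WeierstrassCurve ℚ) L₀ hL₀ (hsq S hS L₀ hL₀)
    (Or.inr hasMultiplicativeReductionAtPrime_three_fiftySevenC) W D dvd_rfl nine_dvd hf hopt

/-- **`3 ∤ c` on the class `171c`, modulo the root squeeze** (the C3 shape). [cite: AgasheRibetStein2006, §§1–2] -/
theorem not_three_dvd_maninConstant_171c_of_rootSqueeze (hsq : ∀ S : Fin 3 → CuspForm (Gamma0 171) 2, (∀ i, ∀ τ : ℍ, S i τ = etaQuotient 171 (expFn (Ls[(i : ℕ)]).1) τ) →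
      ∀ L₀ : PeriodPair, IsNeronLatticeOf ((⟨0, 1, 1, 20, -32⟩ : WeierstrassCurve ℚ).baseChange ℂ) L₀ → ∀ z ∈ periodLattice (rootForm w57c S), z ∈ L₀.lattice)
    (W : WeierstrassCurve ℚ) [W.IsElliptic] [W.IsGloballyMinimal] (D : ModularParametrizationData W 171) (h2 : W.LFunction 2 = 2) (h5 : W.LFunction 5 = -1)
    (hopt : ∀ z ∈ D.L.lattice, ∃ w ∈ periodLattice D.f, z = D.c * w) : ¬ (3 : ℤ) ∣ D.maninConstant := by
  intro hd
  have h1 := abs_maninConstant_eq_one_171c_of_rootSqueeze hsq W D h2 h5 hopt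
  have hn : D.maninConstant.natAbs = 1 := by
    rw [Int.abs_eq_natAbs] at h1
    exact_mod_cast h1
  have h2' : (3 : ℤ).natAbs ∣ 1 := hn ▸ Int.natAbs_dvd_natAbs.mpr hd
  norm_num at h2'

/-- **Row `171d` selected by `a₂, a₅`**: `D.f = 57a|₁₇₁ ⊗ χ₋₃` for some seeds `S`. [cite: CremonaAlgorithms1997, Table 1 (171d)] -/
theorem f_eq_charTwist_57a_of_lFunction (D : ModularParametrizationData W 171) (h2 : W.LFunction 2 = 2) (h5 : W.LFunction 5 = 3) :
    ∃ S : Fin 3 → CuspForm (Gamma0 171) 2, (∀ i, ∀ τ : ℍ, S i τ = etaQuotient 171 (expFn (Ls[(i : ℕ)]).1) τ) ∧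
      D.f = charTwist 171 dvd_rfl nine_dvd (isQuadratic_quadraticChar_ringHomComp 3) (rootForm w57a S) := by
  obtain ⟨S, hS, h⟩ := f_cases D
  refine ⟨S, hS, ?_⟩
  have key : ∀ r : List (ℕ × ℤ) × ℤ × List ℤ, truth W [3, 2, 5, 7, 11, 13] = r.1 →
      (r.1.getD 1 (0, 0)).2 = W.LFunction 2 ∧ (r.1.getD 2 (0, 0)).2 = W.LFunction 5 := fun r hr ↦ by
    constructor <;> simp [← hr, truth]
  rcases h with h | h | h | h | h | h | h | h
  · exact absurd ((key _ h).1.trans h2) (by decide)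
  · exact absurd ((key _ h).1.trans h2) (by decide)
  · exact absurd ((key _ h.1).1.trans h2) (by decide)
  · exact absurd ((key _ h.1).1.trans h2) (by decide)
  · exact absurd ((key _ h).1.trans h2) (by decide)
  · exact absurd ((key _ h).1.trans h2) (by decide)
  · exact absurd ((key _ h.1).2.trans h5) (by decide)
  · exact h.2

/-- **`|c| = 1` ON THE CLASS `171d = 57a ⊗ χ₋₃`, MODULO THE ROOT SQUEEZE `hsq`** (`Λ₁₇₁(57a|₁₇₁) ⊆ Λ_Néron([0, -1, 1, -2, 2])` for all seeds; lattice-optimal `X₀(171)`-data of globally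
minimal models; p3 68.A at `p = 3` with `M = N = 171`). [cite: Stevens1989, Lemma (5.2) p. 96, Lemma (5.4) p. 97] [cite: AgasheRibetStein2006, §§1–2] -/
theorem abs_maninConstant_eq_one_171d_of_rootSqueeze (hsq : ∀ S : Fin 3 → CuspForm (Gamma0 171) 2, (∀ i, ∀ τ : ℍ, S i τ = etaQuotient 171 (expFn (Ls[(i : ℕ)]).1) τ) →
      ∀ L₀ : PeriodPair, IsNeronLatticeOf ((⟨0, -1, 1, -2, 2⟩ : WeierstrassCurve ℚ).baseChange ℂ) L₀ → ∀ z ∈ periodLattice (rootForm w57a S), z ∈ L₀.lattice)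
    (W : WeierstrassCurve ℚ) [W.IsElliptic] [W.IsGloballyMinimal] (D : ModularParametrizationData W 171) (h2 : W.LFunction 2 = 2) (h5 : W.LFunction 5 = 3)
    (hopt : ∀ z ∈ D.L.lattice, ∃ w ∈ periodLattice D.f, z = D.c * w) : |D.maninConstant| = 1 := by
  haveI : Fact (Nat.Prime 3) := ⟨Nat.prime_three⟩
  obtain ⟨S, hS, hf⟩ := f_eq_charTwist_57a_of_lFunction D h2 h5
  haveI := isElliptic_fiftySevenA
  haveI := isGloballyMinimal_fiftySevenA
  obtain ⟨L₀, hL₀⟩ := exists_isNeronLatticeOf_holds ((⟨0, -1, 1, -2, 2⟩ : WeierstrassCurve ℚ).baseChange ℂ)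
  exact abs_maninConstant_eq_one_of_rootForm_charTwist_eq (p := 3) (by norm_num) (isQuadratic_quadraticChar_ringHomComp 3)
    (isPrimitive_quadraticChar_ringHomComp 3 (by norm_num)) (rootForm w57a S) (⟨0, -1, 1, -2, 2⟩ : WeierstrassCurve ℚ) L₀ hL₀ (hsq S hS L₀ hL₀)
    (Or.inr hasMultiplicativeReductionAtPrime_three_fiftySevenA) W D dvd_rfl nine_dvd hf hopt

/-- **`3 ∤ c` on the class `171d`, modulo the root squeeze** (the C3 shape). [cite: AgasheRibetStein2006, §§1–2] -/
theorem not_three_dvd_maninConstant_171d_of_rootSqueeze (hsq : ∀ S : Fin 3 → CuspForm (Gamma0 171) 2, (∀ i, ∀ τ : ℍ, S i τ = etaQuotient 171 (expFn (Ls[(i : ℕ)]).1) τ) →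
      ∀ L₀ : PeriodPair, IsNeronLatticeOf ((⟨0, -1, 1, -2, 2⟩ : WeierstrassCurve ℚ).baseChange ℂ) L₀ → ∀ z ∈ periodLattice (rootForm w57a S), z ∈ L₀.lattice)
    (W : WeierstrassCurve ℚ) [W.IsElliptic] [W.IsGloballyMinimal] (D : ModularParametrizationData W 171) (h2 : W.LFunction 2 = 2) (h5 : W.LFunction 5 = 3)
    (hopt : ∀ z ∈ D.L.lattice, ∃ w ∈ periodLattice D.f, z = D.c * w) : ¬ (3 : ℤ) ∣ D.maninConstant := by
  intro hd
  have h1 := abs_maninConstant_eq_one_171d_of_rootSqueeze hsq W D h2 h5 hopt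
  have hn : D.maninConstant.natAbs = 1 := by
    rw [Int.abs_eq_natAbs] at h1
    exact_mod_cast h1
  have h2' : (3 : ℤ).natAbs ∣ 1 := hn ▸ Int.natAbs_dvd_natAbs.mpr hd
  norm_num at h2'

end Summit.BirchSwinnertonDyer.BirchSwinnertonDyer.Theorems.ManinLocalTwoThree.LevelOneSeventyOne

end
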